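import Literature.NumberTheory.EllipticCurves.YanZhu2026.TwoVariableMainTheorems
import Literature.NumberTheory.EllipticCurves.Rank1Residual.Predicates
import Literature.NumberTheory.GaloisRepresentations.ResidualGaloisRep
import HarnessLib

/-!
# Burungale–Castella–Skinner 2025, §1.4 "On the two-variable Main Conjectures": the set `V` of
# vexing primes for `E[p]` and Theorem 1.4.1 — the ORDINARY two-variable main theorem for `E/K`
# over the `ℤ_p²`-extension, rationally under (irr_ℚ) (a), integrally under (sur) (b) — as a NAMED
# FACT in the tree's two-variable currency (typing layer D-0088(4), seat `bsd-littype-03`, gen 2)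

HONEST FRAMING. This file TYPES one published theorem as a named fact (`def … : Prop`, nothing
asserted, no `_holds`; D-0014) and DEFINES one printed notion (the vexing set `V`); everything else is
proved bookkeeping. Typed ≠ proved ≠ endorsed. It closes the row "Thm. 1.4.1 — GAP-2VAR" of the seat's
locator sheet (`run/shared/lean/pub/bsd-littype/staging/bsd-littype-03/SHEETS-03.md` §1 row 15, §4),
which became typable once the Selmer-side carrier `WeierstrassCurve.XOrd₂` (this seat, gen 0,
`TwoVariableSelmerDual.lean`) and the `L`-side carrier of the SAME normalisation
(`IsHidaRankinLFunction` / `perrinRiouLFunction`, seat `bsd-littype-04`,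
`YanZhu2026/TwoVariableMainTheorems.lean`) were in the tree. NOTHING is restated: the vocabulary of
those two files is imported and cited by name. Siblings in this directory (gen 0 of this seat and
earlier): `HeegnerPointMainConjecture.lean` (Thm. 1.2.2, Thm. 4.2.1 (a)), `BDPMainConjecture.lean`
(Thm. 1.2.4, Thm. 4.2.1 (b), Prop. 4.2.2), `CyclotomicMainTheoremIntegral.lean` (Thm. 1.1.2 (b)),
`BDPMainConjectureAtTrivialCharacter.lean`, `PPartBSD.lean` (Cor. 1.3.1).

## Source (read on the store's text `paper:arxiv-2405.00270` = arXiv:2405.00270v2, 12 pp.)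

A. Burungale, F. Castella, C. Skinner, *Base change and Iwasawa main conjectures for GL₂*, Int. Math.
Res. Not. IMRN **2025**, no. 8, rnaf082 (doi:10.1093/imrn/rnaf082) = arXiv:2405.00270v2 (18 Mar 2025).
REFEREED / PUBLISHED. Bib key `BurungaleCastellaSkinner2025`. §1.4, p. 4
(`[corpus: paper:arxiv-2405.00270 p0004 L50–L79]`), verbatim:

> **1.4. On the two-variable Main Conjectures.** Our approach to the above theorems also gives a
> proof of the two-variable Iwasawa Main Conjectures for `E/K` under an additional hypothesis on
> `E[p]`. For the precise statement, following terminology in [Dia97], consider the set of "vexing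
> primes" for `E[p]`: `V := {ℓ ≡ −1 (mod p) | ρ̄_E|_{G_{ℚ_ℓ}} is irreducible and ρ̄_E|_{I_ℓ} is
> reducible}`, where `I_ℓ ⊂ G_{ℚ_ℓ}` are inertia and decomposition groups at `ℓ`, respectively. Let
> `K_∞/K` denote the `ℤ_p²`-extension of `K`, and put `Γ_K = Gal(K_∞/K)` and `Λ_K = ℤ_p[[Γ_K]]`. Let
> `X^ord(E/K_∞)` be the Pontryagin dual of the Selmer group `Sel_{p^∞}(E/K_∞)`, and let
> `L_p^PR(E/K) ∈ Λ_K` be the two-variable `p`-adic Rankin `L`-series constructed by Perrin-Riou [PR88]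
> (normalized as in [CGS23, §1.2]).
>
> **Theorem 1.4.1.** Let `(E, p, K)` be as in Theorem 1.2.2. Assume that `V = ∅`. (a) If `p > 3`
> satisfies (irr_ℚ), then `X^ord(E/K_∞)` is `Λ_K`-torsion, with `ch_{Λ_K}(X^ord(E/K_∞)) =
> (L_p^PR(E/K))` in `Λ_K ⊗ ℚ_p`. (b) If further `p > 3` satisfies (sur), then the equality of
> characteristic ideals holds in `Λ_K`.

"as in Theorem 1.2.2" (p. 3, `[p0003 L36–L37]`): "Let `E` be an elliptic curve defined over `ℚ` of
conductor `N`, `p` be a prime of good ordinary reduction for `E`, and `K` an imaginary quadratic field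
satisfying (disc), (Heeg), and (spl)", with (p. 2, `[p0002 L40–L47]`) "(disc): `D_K` is odd and
`D_K ≠ −3`", "(Heeg): every prime `ℓ | N` splits in `K`", "(spl): `p = v v̄` splits in `K`";
"(irr_ℚ): `E[p]` is an irreducible `G_ℚ`-module" (p. 2), "(sur): `ρ̄_E : G_ℚ → Aut_{𝔽_p}(E[p])` is
surjective" (p. 3). Printed proof: p. 11 `[p0011 L35–L75]` (two auxiliary real quadratic fields
`F, F'` as in Lemma 5.2.3, the equalities of Thm. 1.2.4, the divisibility (5.5) of Prop. 5.2.1, the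
non-vanishing of `L_p^BDP`, [SU14, Lem. 3.2]; "When `V = ∅`, condition (H3) in Hypothesis 3.1.1 is
vacuous, and therefore the argument … applies for any real quadratic `F₀` satisfying conditions
(i)–(ii) and (iv)–(vi) in Lemma 5.2.3, but not necessarily (iii)"; then "together with Proposition
4.1.3 yields the result" — i.e. Thm. 4.1.3, the [BSTW23] equivalence of the `X^ord`/`L_p^PR` and
`X_Gr`/`L_p^Gr` two-variable statements). PROVENANCE FLAG `BCS25-IMC-equiv@BSTW` (cell D1; module
docstring of `BDPMainConjecture.lean`): the printed proof passes through Thm. 4.1.3 = [BSTW23, §9.3.2],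
a PREPRINT input (arXiv:2409.01350) of a PUBLISHED theorem; the fact below is typed as IMRN prints it.

## Transcription (tree vocabulary only; every carrier cited by name, none re-declared)

* `Γ_K`, `Λ_K`, `X^ord(E/K_∞)`: a pair of `ℤ_p`-extensions `κ₁, κ₂ : Γ_K ↠ ℤ_p` of `K` with an
  adapted topological generator pair `(γ₁, γ₂)` (`ZpExtension.IsTopGeneratorPair`, as a `Fact`
  instance); `K̃_∞ = K̄^{pairKer κ₁ κ₂}` is then a `ℤ_p²`-extension of `K`
  (`TwoVariableSelmer.exists_apply_eq_of_isTopGeneratorPair`), hence THE `ℤ_p²`-extension `K_∞` for `K`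
  imaginary quadratic; `Λ_K = IwasawaAlgebra₂ p = ℤ_p⟦T₂⟧⟦T₁⟧`, `1 + T_i ↔ γ_i`;
  `X^ord(E/K_∞) = (W.baseChange K).XOrd₂ p κ₁ κ₂ γ₁ γ₂ = Hom(Sel_{p^∞}(E/K̃_∞), ℚ/ℤ)` with its
  CONSTRUCTED `Λ₂`-module structure and `ch_{Λ_K} = WeierstrassCurve.XOrd₂.charIdeal`
  (`TwoVariableSelmerDual.lean`) — literally the printed "Pontryagin dual of the Selmer group
  `Sel_{p^∞}(E/K_∞)`" (no reading flag needed on the Selmer side). The statement is coordinate-free in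
  print (ideals of `ℤ_p[[Γ_K]]`); module and `L`-function below are written in the SAME coordinates
  `(γ₁, γ₂)`, so no cyclotomic/anticyclotomic normalisation of the pair is imposed.
* `L_p^PR(E/K)` "constructed by Perrin-Riou [PR88] (normalized as in [CGS23, §1.2])": [CGS23, §1.2] =
  arXiv:2303.04373v1 §1.2 = Math. Ann. 393 (2025) §2.2 — Thm. 1.2.1 (= print 2.2.1: the element
  `𝓛_p(f/K, Σ^{(1)}) ∈ c_f⁻¹Λ_K` with `𝓛_p(f/K,Σ^{(1)})(ψ) = W(ψ) p^{(m+n)/2} α_p^{-(m+n)} H_p(f)⁻¹ ·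
  L(f/K, ψ̄, 1)/(8π²⟨f,f⟩_N)` at finite-order `ψ` of conductor `v^m v̄^n`, `H_p(f) = (1 − p/α_p²)(1 − 1/α_p²)`,
  `[corpus: paper:arxiv-2303.04373 p0007 L74–L140, p0008 L1–L21]`) and Def. 1.2.2 (= print 2.2.2:
  "`𝓛_p^PR(E/K) := deg(π_E)/c_E² · H_p(f) · 𝓛_p(f/K, Σ^{(1)})`, where `c_E` is the Manin constant
  associated to `π_E`", `[p0008 L23–L31]`). This is VERBATIM Yan–Zhu 2026 Thm. 3.3 / Def. 3.4 ("as
  given in [CGS, Thm. 2.2.1]"), already typed as the characterising predicate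
  `IsHidaRankinLFunction ι W κ₁ κ₂ f F` (+ the integrality clause `IsCongruenceIntegral f F`,
  "`∈ c_f⁻¹Λ_K`") and the operation `perrinRiouLFunction W π F = C(perrinRiouConstant W π) · F` on
  `F ∈ ℚ_p⟦T⟧⟦S⟧ = CycAntiSeries p` (outer variable `↔ γ₁`, inner `↔ γ₂`; `Λ_K ↪ ℚ_p⟦T⟧⟦S⟧` =
  `IwasawaAlgebra₂.toCycAnti`), seat `bsd-littype-04`, file `YanZhu2026/TwoVariableMainTheorems.lean`
  — USED here, with its reading flag `YZ-33-range` inherited (the interpolation is demanded only at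
  characters ramified at both primes above `p`, a Zariski-dense set; WEAKER than print). The modular
  parametrisation `π_E : X₀(N) → E` of Def. 1.2.2 is the binder `π : ModularParametrizationData W N`
  (`π.f = f_E` the newform with `π.isNewformOf`, `π.deg = deg π_E`, `π.c = c_E`).
* "`=` in `Λ_K ⊗ ℚ_p`" / "`=` in `Λ_K`": equality of the ideals `ch(X)·Λ_K[1/p]` and `𝓛·Λ_K[1/p]`, resp.
  of `ch(X)` and `𝓛Λ_K`, read elementwise along the injective ring map `toCycAnti : Λ_K → ℚ_p⟦T⟧⟦S⟧`
  (NOT as ideals of `ℚ_p⟦T⟧⟦S⟧`, where `p` is a unit): integrally the existing pair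
  `IwasawaAlgebra₂.IdealLeSpan` ("`ch ⊂ (𝓛)`": every `g ∈ ch` is `𝓛 · h`, `h ∈ Λ_K`) and
  `IwasawaAlgebra₂.SpanLeIdeal` ("`(𝓛) ⊂ ch`": `𝓛 = ι(g)` for some `g ∈ ch`); rationally the two
  `p`-power-slack companions `IdealLeSpanRat` / `SpanLeIdealRat` DEFINED in §A below (every `g ∈ ch`
  has `p^a g = 𝓛 · h`; `p^b 𝓛 = ι(g)` for some `g ∈ ch`), which say exactly `ch·Λ_K[1/p] ⊆ 𝓛·Λ_K[1/p]`
  and `⊇` (`Λ_K[1/p]` is a domain). Integral implies rational (`IdealLeSpan.rat`, `SpanLeIdeal.rat`).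
* (irr_ℚ) = `Rank1Residual.Irr W p`, (sur) = `Rank1Residual.Surj W p`, "good ordinary" =
  `Rank1Residual.GoodOrd W p`, "`p > 3`" = `3 < p`; (disc), (Heeg), (spl), "imaginary quadratic" exactly
  as in the sibling facts `thm122a_…` / `thm124a_…` of this directory (`Odd (discr K)`,
  `discr K ≠ −3`, `SatisfiesHeegnerHypothesis N K` at the level `N` of `π.f` (= `N_E`, `IsNewformOf`),
  two primes of `𝒪_K` over `p`, `IsImaginaryQuadratic K`).
* `V = ∅`: `vexingPrimes W p = ∅` with `vexingPrimes` DEFINED in §B — READING FLAG `BCS-V-absolute`: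
  "irreducible"/"reducible" on p. 4 are read as ABSOLUTELY (ir)reducible, the wording of the same
  condition where it is used, Hyp. 3.1.1 (H3) (p. 7, `[p0007 L8–L11]`: "if `ρ̄_g|_{G_{F_v}}` is absolutely
  irreducible and `ρ̄_g|_{I_v}` is absolutely reducible, then `q_v ≢ −1 (mod p)`"; proof of Thm. 1.4.1,
  p. 11: "When `V = ∅`, condition (H3) in Hypothesis 3.1.1 is vacuous"), and the meaning of [Dia97]'s
  terminology. (With plain `𝔽_p`-irreducibility the printed set would contain, for every curve with
  (sur), infinitely many UNRAMIFIED primes `ℓ ≡ −1 (mod p)` — those whose Frobenius has irreducible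
  characteristic polynomial mod `p`, by Chebotarev — and Thm. 1.4.1 would be vacuous; with the absolute
  reading an unramified `ℓ` has cyclic, hence abelian, image of `G_{ℚ_ℓ}` and is never vexing, so
  `V ⊆ {ℓ ∣ N}` is finite and decidable from local data.) Absolute irreducibility of the restriction of
  `ρ̄_{E,p}` to a closed subgroup `D ≤ Γ_ℚ` is the tree's `IsAbsIrreducible` (`ResidualGaloisRep.lean`)
  of the restriction `ρ ∘ D.subtype` of an `𝔽_p`-framing `ρ` of `E[p]` (`W.IsTorsionGaloisRep p ρ`,
  `BCDTModularity.lean`; all framings are `GL₂(𝔽_p)`-conjugate, so "every framing" = "some framing"),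
  `D = 𝔓.decompositionSubgroup Γ_ℚ ⊇ 𝔓.inertia Γ_ℚ` for a prime `𝔓` of `ℤ̄` over `ℓ`
  (`IntegralGaloisAction.lean`, the vocabulary of `Rank1Residual.LineUnramifiedAt`; conjugate `𝔓` give
  conjugate subgroups, so "every `𝔓`" = "some `𝔓`").

FAITHFULNESS. `thm141_…` is FAITHFUL to print on the Selmer side and in the hypotheses; on the
`L`-side it names `L_p^PR` by the SAME printed construction ([CGS23, Def. 1.2.2] = [YZ26, Def. 3.4])
through a characterising predicate demanded on a Zariski-dense subset of the printed interpolation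
range (flag `YZ-33-range`) and ∃-quantified ⇒ WEAKER than print (a consequence of the printed theorem
together with the printed existence [CGS23, Thm. 1.2.1]); (a) and (b) are recorded in ONE fact, (b) as
the clause `Surj W p → …` (the shape of `YanZhu2026.thm42_…` with its (Im) clause). Not STRONGER than
print anywhere. NOT typed (GAPS, unchanged from SHEETS-03 §3 except as noted): statements 4.1.1/4.1.2
of the source (Summits-side `@[conjecture]` leaves — a planner's filing; 4.1.1's content for
`(E, K, p)` is exactly the (b)-conclusion below without (Heeg)/(disc)/`V`), Thm. 4.1.3 / Cor. 4.1.4 /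
the `L_p^Gr` half of Prop. 4.2.2 (need the two-variable `L_p^Gr ∈ Λ_K^ur`, whose one missing carrier
is Hida's type-II Rankin–Selberg function, cf. the GAP note of `YanZhu2026/TwoVariableMainTheorems.lean`),
§§2–3 and Lemmas 5.1.1–5.1.2 / Prop. 5.2.1 (Hilbert modular forms over the real quadratic `F`,
`(d+1)`-variable `Λ_M`: absent from Mathlib).

## References
* [BurungaleCastellaSkinner2025] IMRN 2025 rnaf082 = arXiv:2405.00270v2: §1.4 (p. 4: `V`,
  `X^ord(E/K_∞)`, `L_p^PR(E/K)`, Thm. 1.4.1, Rem. 1.4.2), Hyp. 3.1.1 (H3) (p. 7), proof of Thm. 1.4.1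
  (p. 11).
* [CastellaGrossiSkinner2025] Math. Ann. 393 (2025) = arXiv:2303.04373: §1.2 of v1 (Thm. 1.2.1,
  Def. 1.2.2, Rem. 1.2.3) = §2.2 of print — the normalisation of `L_p^PR`.
* [YanZhu2024MainConjNonCM] J. Algebra 693 (2026): Thm. 3.3, Def. 3.4 (the same `𝓛_p^I`, `𝓛_p^PR`) —
  tree `IsHidaRankinLFunction`, `perrinRiouLFunction`, `IdealLeSpan`, `SpanLeIdeal`.
* F. Diamond, *An extension of Wiles' results*, in: Modular Forms and Fermat's Last Theorem (Boston
  1995), Springer 1997, 475–489 (= BCS's [Dia97]; the terminology "vexing primes").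
* B. Perrin-Riou, J. London Math. Soc. (2) 38 (1988) (= [PR88]); J. Nekovář, Math. Ann. 302 (1995)
  (0.5) — the same function in Nekovář's normalisation is the tree's `IsTwoVariablePAdicLFunctionK`
  (`TwoVariablePAdicLFunctionK.lean`); by comparison of the printed interpolation formulae it differs
  from `𝓛_p(f/K, Σ^{(1)})` by the constants `|D_K|^{1/2}`, `H_p(f)` and the values `𝒲(N)𝒲̄((√D_K))` of a
  group-like unit of `Λ_K` (same root number: Hecke's functional equation), hence generates the same
  ideal of `Λ_K ⊗ ℚ_p` — recorded for the cell's reading flag `BCS-141-LPR-normalisation`, not used.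
-/

noncomputable section

open scoped Classical

open PowerSeries NumberField IsDedekindDomain Field CongruenceSubgroup
  Literature.NumberTheory.GaloisRepresentations Literature.NumberTheory.EllipticCurves
  Literature.NumberTheory.EllipticCurves.ModularForms Literature.NumberTheory.EllipticCurves.Rank1Residual

universe u

/-! ## §A. "`J = (L)` in `Λ_K ⊗ ℚ_p`": the rational companions of `IdealLeSpan` / `SpanLeIdeal` -/

namespace Literature.NumberTheory.EllipticCurves.IwasawaAlgebra₂

variable {p : ℕ} [Fact p.Prime]

/-- **`J ⊂ (L)` in `Λ_K ⊗ ℚ_p`** for an ideal `J ⊆ Λ_K = ℤ_p⟦T₂⟧⟦T₁⟧` and a series `L ∈ ℚ_p⟦T⟧⟦S⟧` (meant: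
`L ∈ Λ_K ⊗ ℚ_p`): every `g ∈ J` satisfies `p^a · g = L · h` for some `a ∈ ℕ`, `h ∈ Λ_K`, read along the
injective ring map `toCycAnti : Λ_K → ℚ_p⟦T⟧⟦S⟧` — i.e. `J · Λ_K[1/p] ⊆ L · Λ_K[1/p]` ("in `Λ_K ⊗ ℚ_p`",
`Λ_K ⊗ ℚ_p = Λ_K[1/p]`). The `p`-power-slack companion of `IdealLeSpan` (the integral "`J ⊂ (L)`").
[cite: BurungaleCastellaSkinner2025, Thm. 1.4.1 (a) ("in Λ_K ⊗ ℚ_p", p. 4 of arXiv:2405.00270v2)] -/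
def IdealLeSpanRat (J : Ideal (IwasawaAlgebra₂ p)) (L : CycAntiSeries p) : Prop :=
  ∀ g ∈ J, ∃ (a : ℕ) (h : IwasawaAlgebra₂ p), toCycAnti p ((p : IwasawaAlgebra₂ p) ^ a * g) =
    L * toCycAnti p h

/-- **`(L) ⊂ J` in `Λ_K ⊗ ℚ_p`**: `p^b · L` is (the image of) an element of `J` for some `b ∈ ℕ` — i.e.
`L · Λ_K[1/p] ⊆ J · Λ_K[1/p]`. The `p`-power-slack companion of `SpanLeIdeal`.
[cite: BurungaleCastellaSkinner2025, Thm. 1.4.1 (a) ("in Λ_K ⊗ ℚ_p", p. 4 of arXiv:2405.00270v2)] -/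
def SpanLeIdealRat (L : CycAntiSeries p) (J : Ideal (IwasawaAlgebra₂ p)) : Prop :=
  ∃ (b : ℕ), ∃ g ∈ J, toCycAnti p g = PowerSeries.C (PowerSeries.C ((p : ℚ_[p]) ^ b)) * L

/-- The integral inclusion `J ⊂ (L)` implies the rational one (take `a = 0`).
[cite: BurungaleCastellaSkinner2025, Thm. 1.4.1 ((b) refines (a), p. 4 of arXiv:2405.00270v2)] -/
theorem IdealLeSpan.rat {J : Ideal (IwasawaAlgebra₂ p)} {L : CycAntiSeries p} (h : IdealLeSpan J L) :
    IdealLeSpanRat J L := by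
  intro g hg
  obtain ⟨k, hk⟩ := h g hg
  exact ⟨0, k, by rw [pow_zero, one_mul, hk]⟩

/-- The integral inclusion `(L) ⊂ J` implies the rational one (take `b = 0`).
[cite: BurungaleCastellaSkinner2025, Thm. 1.4.1 ((b) refines (a), p. 4 of arXiv:2405.00270v2)] -/
theorem SpanLeIdeal.rat {L : CycAntiSeries p} {J : Ideal (IwasawaAlgebra₂ p)} (h : SpanLeIdeal L J) :
    SpanLeIdealRat L J := by
  obtain ⟨g, hg, hgL⟩ := h
  refine ⟨0, g, hg, ?_⟩
  rw [pow_zero, map_one, map_one, one_mul, hgL]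

/-- Monotonicity of `IdealLeSpanRat` in the ideal. [cite: BurungaleCastellaSkinner2025, Thm. 1.4.1 (a) (p. 4 of arXiv:2405.00270v2)] -/
theorem IdealLeSpanRat.mono {J J' : Ideal (IwasawaAlgebra₂ p)} {L : CycAntiSeries p} (hJ : J ≤ J')
    (h : IdealLeSpanRat J' L) : IdealLeSpanRat J L :=
  fun g hg ↦ h g (hJ hg)

/-- `(L) ⊂ J` rationally forces `J ≠ ⊥` as soon as `L ≠ 0` (`toCycAnti` is a ring map and `p ≠ 0` in
`ℚ_p`). [cite: BurungaleCastellaSkinner2025, Thm. 1.4.1 (a) (p. 4 of arXiv:2405.00270v2)] -/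
theorem SpanLeIdealRat.ne_bot {L : CycAntiSeries p} {J : Ideal (IwasawaAlgebra₂ p)}
    (h : SpanLeIdealRat L J) (hL : L ≠ 0) : J ≠ ⊥ := by
  rintro rfl
  obtain ⟨b, g, hg, hgL⟩ := h
  rw [Ideal.mem_bot] at hg
  rw [hg, map_zero] at hgL
  have hpb : (PowerSeries.C (PowerSeries.C ((p : ℚ_[p]) ^ b)) : CycAntiSeries p) ≠ 0 := by
    rw [Ne, ← map_zero (PowerSeries.C (R := PowerSeries ℚ_[p])),
      (PowerSeries.C_injective (R := PowerSeries ℚ_[p])).eq_iff,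
      ← map_zero (PowerSeries.C (R := ℚ_[p])), (PowerSeries.C_injective (R := ℚ_[p])).eq_iff]
    exact pow_ne_zero _ (Nat.cast_ne_zero.mpr (Fact.out : p.Prime).ne_zero)
  exact (mul_ne_zero hpb hL) hgL.symm

end Literature.NumberTheory.EllipticCurves.IwasawaAlgebra₂

/-! ## §B. The set `V` of vexing primes for `E[p]` (BCS §1.4, following [Dia97]) -/

namespace Literature.NumberTheory.EllipticCurves.BurungaleCastellaSkinner2025

open IwasawaAlgebra₂

section Vexing

variable (W : WeierstrassCurve ℚ) (p : ℕ) [Fact p.Prime]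

/-- **`ℓ` is a vexing prime for `E[p]`** (Burungale–Castella–Skinner 2025, §1.4, p. 4, "following
terminology in [Dia97]"): "`V := {ℓ ≡ −1 (mod p) | ρ̄_E|_{G_{ℚ_ℓ}} is irreducible and ρ̄_E|_{I_ℓ} is
reducible}`, where `I_ℓ ⊂ G_{ℚ_ℓ}` are inertia and decomposition groups at `ℓ`". Transcribed with the
ABSOLUTE reading of the same condition in Hyp. 3.1.1 (H3), p. 7 ("`ρ̄_g|_{G_{F_v}}` is absolutely
irreducible and `ρ̄_g|_{I_v}` is absolutely reducible") — reading flag `BCS-V-absolute`, module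
docstring: `ℓ` is a prime with `p ∣ ℓ + 1` such that for every `𝔽_p`-framing
`ρ : Γ_ℚ →ₜ* GL₂(𝔽_p)` of `E[p]` (`W.IsTorsionGaloisRep p ρ`) and every prime `𝔓` of `ℤ̄` above `ℓ`
(`v.primesAbove` for the place `v ∋ ℓ` of `ℚ`), the restriction of `ρ` to the decomposition group
`D_𝔓 = 𝔓.decompositionSubgroup Γ_ℚ` is absolutely irreducible (`IsAbsIrreducible`, irreducible after
every extension of scalars) and its restriction to the inertia group `I_𝔓 = 𝔓.inertia Γ_ℚ` is not.
(Framings are `GL₂(𝔽_p)`-conjugate and primes above `ℓ` are `Γ_ℚ`-conjugate, so "every" = "some".)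
[cite: BurungaleCastellaSkinner2025, §1.4 (the set V, p. 4 of arXiv:2405.00270v2) and Hyp. 3.1.1 (H3) (p. 7)] -/
def IsVexingPrime (ℓ : ℕ) : Prop :=
  ℓ.Prime ∧ p ∣ ℓ + 1 ∧
    ∀ ρ : ModPGaloisRep ℚ (ZMod p) 2, W.IsTorsionGaloisRep p ρ →
      ∀ v : HeightOneSpectrum (𝓞 ℚ), (ℓ : 𝓞 ℚ) ∈ v.asIdeal →
        ∀ 𝔓 ∈ v.primesAbove,
          IsAbsIrreducible
              (ρ.toMonoidHom.comp (𝔓.decompositionSubgroup (absoluteGaloisGroup ℚ)).subtype) ∧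
            ¬ IsAbsIrreducible (ρ.toMonoidHom.comp (𝔓.inertia (absoluteGaloisGroup ℚ)).subtype)

/-- **The set `V` of vexing primes for `E[p]`** (BCS §1.4, p. 4): `V = {ℓ | IsVexingPrime W p ℓ}`. The
hypothesis of Thm. 1.4.1 is `V = ∅`. [cite: BurungaleCastellaSkinner2025, §1.4 (the set V, p. 4 of arXiv:2405.00270v2)] -/
def vexingPrimes : Set ℕ :=
  {ℓ | IsVexingPrime W p ℓ}

variable {W p}

/-- Membership in `V` (definitional). [cite: BurungaleCastellaSkinner2025, §1.4 (p. 4 of arXiv:2405.00270v2)] -/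
@[simp] theorem mem_vexingPrimes_iff {ℓ : ℕ} : ℓ ∈ vexingPrimes W p ↔ IsVexingPrime W p ℓ :=
  Iff.rfl

/-- A vexing prime is a prime `ℓ ≡ −1 (mod p)`. [cite: BurungaleCastellaSkinner2025, §1.4 (p. 4 of arXiv:2405.00270v2)] -/
theorem IsVexingPrime.prime_and_dvd {ℓ : ℕ} (h : IsVexingPrime W p ℓ) : ℓ.Prime ∧ p ∣ ℓ + 1 :=
  ⟨h.1, h.2.1⟩

/-- Primes `ℓ ≢ −1 (mod p)` are not vexing. [cite: BurungaleCastellaSkinner2025, §1.4 (p. 4 of arXiv:2405.00270v2)] -/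
theorem not_isVexingPrime_of_not_dvd {ℓ : ℕ} (h : ¬ p ∣ ℓ + 1) : ¬ IsVexingPrime W p ℓ :=
  fun hℓ ↦ h hℓ.2.1

/-- `p` itself is not vexing (for a prime `p`, `p ∤ p + 1`). [cite: BurungaleCastellaSkinner2025, §1.4 (p. 4 of arXiv:2405.00270v2)] -/
theorem not_isVexingPrime_self : ¬ IsVexingPrime W p p := by
  refine not_isVexingPrime_of_not_dvd fun h ↦ ?_
  have h1 : p ∣ 1 := (Nat.dvd_add_right (dvd_refl p)).mp h
  exact (Fact.out : p.Prime).one_lt.ne' (Nat.dvd_one.mp h1)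

/-- `V = ∅` iff no prime is vexing; in particular it suffices to rule out the primes `ℓ ≡ −1 (mod p)`
(by `V ⊆ {ℓ ∣ N}` under the absolute reading it even suffices to inspect the bad primes — not
formalised here). [cite: BurungaleCastellaSkinner2025, §1.4 and Thm. 1.4.1 ("Assume that V = ∅", p. 4 of arXiv:2405.00270v2)] -/
theorem vexingPrimes_eq_empty_iff :
    vexingPrimes W p = ∅ ↔ ∀ ℓ : ℕ, ℓ.Prime → p ∣ ℓ + 1 → ¬ IsVexingPrime W p ℓ := by
  rw [Set.eq_empty_iff_forall_notMem]
  refine ⟨fun h ℓ _ _ ↦ h ℓ, fun h ℓ hℓ ↦ ?_⟩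
  exact h ℓ hℓ.1 hℓ.2.1 hℓ

end Vexing

/-! ## §C. Theorem 1.4.1 (named fact) -/

/-- **Burungale–Castella–Skinner, IMRN 2025 (rnaf082) = arXiv:2405.00270v2, Theorem 1.4.1 (§1.4,
p. 4) — the ordinary two-variable main theorem for `E/K`.** Verbatim: "Let `(E, p, K)` be as in
Theorem 1.2.2 [`E/ℚ` of conductor `N`, `p` good ordinary, `K` imaginary quadratic with (disc), (Heeg),
(spl)]. Assume that `V = ∅`. (a) If `p > 3` satisfies (irr_ℚ), then `X^ord(E/K_∞)` is `Λ_K`-torsion,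
with `ch_{Λ_K}(X^ord(E/K_∞)) = (L_p^PR(E/K))` in `Λ_K ⊗ ℚ_p`. (b) If further `p > 3` satisfies (sur),
then the equality of characteristic ideals holds in `Λ_K`." Here `K_∞/K` is the `ℤ_p²`-extension,
`Λ_K = ℤ_p[[Gal(K_∞/K)]]`, `X^ord(E/K_∞)` the Pontryagin dual of `Sel_{p^∞}(E/K_∞)`, and
"`L_p^PR(E/K) ∈ Λ_K` the two-variable `p`-adic Rankin `L`-series constructed by Perrin-Riou [PR88]
(normalized as in [CGS23, §1.2])". TRANSCRIBED (module docstring): `W` a globally minimal model of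
`E/ℚ` with a modular parametrisation `π : ModularParametrizationData W N` by `X₀(N)` (`π.f = f_E`,
`N = N_E`; it carries `deg π_E` and the Manin constant `c_E` of the [CGS23, Def. 1.2.2] normalisation);
`3 < p`, `GoodOrd W p`, `Irr W p`; `K` imaginary quadratic with (Heeg) for `N`, (spl) (two primes of
`𝒪_K` over `p`), (disc) (`D_K` odd, `≠ −3`); `vexingPrimes W p = ∅` (reading flag `BCS-V-absolute`);
`Γ_K` through a pair `(κ₁, κ₂)` of `ℤ_p`-extensions with an adapted generator pair `(γ₁, γ₂)`; `ι` an
embedding datum `ℚ̄ → ℂ_p`. CONCLUSION: there is `F = 𝓛_p(f_E/K, Σ^{(1)})` with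
`IsHidaRankinLFunction ι W κ₁ κ₂ π.f F` and `IsCongruenceIntegral π.f F` ([CGS23, Thm. 1.2.1] =
[YZ26, Thm. 3.3], flag `YZ-33-range`) such that, with `𝓛 = perrinRiouLFunction W π F = L_p^PR(E/K)` and
`X = (W.baseChange K).XOrd₂ p κ₁ κ₂ γ₁ γ₂`: `X` is `Λ₂`-torsion; `ch(X) = (𝓛)` in `Λ_K ⊗ ℚ_p`
(`IdealLeSpanRat ∧ SpanLeIdealRat`); and `Surj W p →` `ch(X) = (𝓛)` in `Λ_K`
(`IdealLeSpan ∧ SpanLeIdeal`). `L`-side ∃-quantified over a characterising predicate ⇒ WEAKER than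
print; not stronger anywhere. PUBLISHED THEOREM (proof p. 11; provenance flag `BCS25-IMC-equiv@BSTW`,
module docstring). [cite: BurungaleCastellaSkinner2025, Thm. 1.4.1 (§1.4, p. 4 of arXiv:2405.00270v2) with the setting of Thm. 1.2.2 (p. 3) and §1.2 (p. 2)]
[cite: CastellaGrossiSkinner2025, Thm. 1.2.1 and Def. 1.2.2 of arXiv:2303.04373v1 §1.2 (= §2.2 of print; the normalisation of L_p^PR)]
[cite: YanZhu2024MainConjNonCM, Thm. 3.3 and Def. 3.4 (the tree carriers IsHidaRankinLFunction / perrinRiouLFunction)] -/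
def thm141_XOrd₂_isTorsion_charIdeal_eq_perrinRiou : Prop :=
  ∀ {p : ℕ} [Fact p.Prime] (ι : integralClosure ℚ ℂ →+* ℂ_[p]) (W : WeierstrassCurve ℚ) [W.IsElliptic]
    [W.IsGloballyMinimal] (K : Type) [Field K] [NumberField K] (κ₁ κ₂ : ZpExtension K p)
    (γ₁ γ₂ : absoluteGaloisGroup K) [Fact (ZpExtension.IsTopGeneratorPair κ₁ κ₂ γ₁ γ₂)]
    {N : ℕ} [NeZero N] (π : ModularParametrizationData W N),
    3 < p → GoodOrd W p → Irr W p → IsImaginaryQuadratic K → SatisfiesHeegnerHypothesis N K →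
      ((Ideal.span {(p : ℤ)}).primesOver (𝓞 K)).ncard = 2 →
      Odd (NumberField.discr K) → NumberField.discr K ≠ -3 →
      vexingPrimes W p = ∅ →
    ∃ F : CycAntiSeries p, IsHidaRankinLFunction ι W κ₁ κ₂ π.f F ∧ IsCongruenceIntegral π.f F ∧
      Module.IsTorsion (IwasawaAlgebra₂ p) ((W.baseChange K).XOrd₂ p κ₁ κ₂ γ₁ γ₂) ∧
      (IdealLeSpanRat (WeierstrassCurve.XOrd₂.charIdeal (W.baseChange K) p κ₁ κ₂ γ₁ γ₂)
          (perrinRiouLFunction W π F) ∧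
        SpanLeIdealRat (perrinRiouLFunction W π F)
          (WeierstrassCurve.XOrd₂.charIdeal (W.baseChange K) p κ₁ κ₂ γ₁ γ₂)) ∧
      (Surj W p →
        IdealLeSpan (WeierstrassCurve.XOrd₂.charIdeal (W.baseChange K) p κ₁ κ₂ γ₁ γ₂)
            (perrinRiouLFunction W π F) ∧
          SpanLeIdeal (perrinRiouLFunction W π F)
            (WeierstrassCurve.XOrd₂.charIdeal (W.baseChange K) p κ₁ κ₂ γ₁ γ₂))

/-! ### Proved unfoldings -/

section API

variable {p : ℕ} [Fact p.Prime] {K : Type} [Field K] [NumberField K]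

/-- Thm. 1.4.1 (a), torsion clause: `X^ord(E/K_∞)` is `Λ_K`-torsion.
[cite: BurungaleCastellaSkinner2025, Thm. 1.4.1 (a) (p. 4 of arXiv:2405.00270v2)] -/
theorem isTorsion_of_thm141 (h : thm141_XOrd₂_isTorsion_charIdeal_eq_perrinRiou)
    (ι : integralClosure ℚ ℂ →+* ℂ_[p]) (W : WeierstrassCurve ℚ) [W.IsElliptic] [W.IsGloballyMinimal]
    (κ₁ κ₂ : ZpExtension K p) (γ₁ γ₂ : absoluteGaloisGroup K)
    [Fact (ZpExtension.IsTopGeneratorPair κ₁ κ₂ γ₁ γ₂)] {N : ℕ} [NeZero N]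
    (π : ModularParametrizationData W N) (hp : 3 < p) (hord : GoodOrd W p) (hirr : Irr W p)
    (hK : IsImaginaryQuadratic K) (hHeeg : SatisfiesHeegnerHypothesis N K)
    (hsplit : ((Ideal.span {(p : ℤ)}).primesOver (𝓞 K)).ncard = 2) (hodd : Odd (NumberField.discr K))
    (h3 : NumberField.discr K ≠ -3) (hV : vexingPrimes W p = ∅) :
    Module.IsTorsion (IwasawaAlgebra₂ p) ((W.baseChange K).XOrd₂ p κ₁ κ₂ γ₁ γ₂) := by
  obtain ⟨-, -, -, htor, -, -⟩ := h ι W K κ₁ κ₂ γ₁ γ₂ π hp hord hirr hK hHeeg hsplit hodd h3 hV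
  exact htor

/-- Thm. 1.4.1 (a), rational equality: `ch(X^ord(E/K_∞)) = (L_p^PR(E/K))` in `Λ_K ⊗ ℚ_p` for some
`L_p^PR` with the printed interpolation property. [cite: BurungaleCastellaSkinner2025, Thm. 1.4.1 (a) (p. 4 of arXiv:2405.00270v2)] -/
theorem rat_of_thm141 (h : thm141_XOrd₂_isTorsion_charIdeal_eq_perrinRiou)
    (ι : integralClosure ℚ ℂ →+* ℂ_[p]) (W : WeierstrassCurve ℚ) [W.IsElliptic] [W.IsGloballyMinimal]
    (κ₁ κ₂ : ZpExtension K p) (γ₁ γ₂ : absoluteGaloisGroup K)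
    [Fact (ZpExtension.IsTopGeneratorPair κ₁ κ₂ γ₁ γ₂)] {N : ℕ} [NeZero N]
    (π : ModularParametrizationData W N) (hp : 3 < p) (hord : GoodOrd W p) (hirr : Irr W p)
    (hK : IsImaginaryQuadratic K) (hHeeg : SatisfiesHeegnerHypothesis N K)
    (hsplit : ((Ideal.span {(p : ℤ)}).primesOver (𝓞 K)).ncard = 2) (hodd : Odd (NumberField.discr K))
    (h3 : NumberField.discr K ≠ -3) (hV : vexingPrimes W p = ∅) :
    ∃ F : CycAntiSeries p, IsHidaRankinLFunction ι W κ₁ κ₂ π.f F ∧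
      IdealLeSpanRat (WeierstrassCurve.XOrd₂.charIdeal (W.baseChange K) p κ₁ κ₂ γ₁ γ₂)
          (perrinRiouLFunction W π F) ∧
        SpanLeIdealRat (perrinRiouLFunction W π F)
          (WeierstrassCurve.XOrd₂.charIdeal (W.baseChange K) p κ₁ κ₂ γ₁ γ₂) := by
  obtain ⟨F, hF, -, -, ⟨hle, hge⟩, -⟩ := h ι W K κ₁ κ₂ γ₁ γ₂ π hp hord hirr hK hHeeg hsplit hodd h3 hV
  exact ⟨F, hF, hle, hge⟩

/-- Thm. 1.4.1 (b) in the form "`ch_{Λ_K}(X^ord(E/K_∞))` is the principal ideal of `Λ_K` generated by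
an element mapping to `L_p^PR(E/K)`", under (sur). [cite: BurungaleCastellaSkinner2025, Thm. 1.4.1 (b) (p. 4 of arXiv:2405.00270v2)] -/
theorem charIdeal_eq_span_of_thm141_of_surj (h : thm141_XOrd₂_isTorsion_charIdeal_eq_perrinRiou)
    (ι : integralClosure ℚ ℂ →+* ℂ_[p]) (W : WeierstrassCurve ℚ) [W.IsElliptic] [W.IsGloballyMinimal]
    (κ₁ κ₂ : ZpExtension K p) (γ₁ γ₂ : absoluteGaloisGroup K)
    [Fact (ZpExtension.IsTopGeneratorPair κ₁ κ₂ γ₁ γ₂)] {N : ℕ} [NeZero N]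
    (π : ModularParametrizationData W N) (hp : 3 < p) (hord : GoodOrd W p) (hirr : Irr W p)
    (hK : IsImaginaryQuadratic K) (hHeeg : SatisfiesHeegnerHypothesis N K)
    (hsplit : ((Ideal.span {(p : ℤ)}).primesOver (𝓞 K)).ncard = 2) (hodd : Odd (NumberField.discr K))
    (h3 : NumberField.discr K ≠ -3) (hV : vexingPrimes W p = ∅) (hsur : Surj W p) :
    ∃ (F : CycAntiSeries p) (g : IwasawaAlgebra₂ p), IsHidaRankinLFunction ι W κ₁ κ₂ π.f F ∧
      toCycAnti p g = perrinRiouLFunction W π F ∧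
      WeierstrassCurve.XOrd₂.charIdeal (W.baseChange K) p κ₁ κ₂ γ₁ γ₂ = Ideal.span {g} := by
  obtain ⟨F, hF, -, -, -, hint⟩ := h ι W K κ₁ κ₂ γ₁ γ₂ π hp hord hirr hK hHeeg hsplit hodd h3 hV
  obtain ⟨hle, hge⟩ := hint hsur
  obtain ⟨g, -, hgL, hspan⟩ := hle.eq_span_of_spanLeIdeal hge
  exact ⟨F, g, hF, hgL, hspan⟩

/-- **Currency check against the sibling typing of Yan–Zhu 2026, Thm. 4.2 (1).** Under the hypotheses
of `YanZhu2026.thm42_XOrd₂_isTorsion_charIdeal_le_perrinRiou` and (Im), that fact yields the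
conclusion of Thm. 1.4.1 in exactly the shape recorded here (torsion, rational equality, integral
equality) — the two named facts speak about the same module `XOrd₂` and the same `L_p^PR`
(`perrinRiouLFunction` of an `IsHidaRankinLFunction` series); they differ only in their hypotheses
(YZ: `ρ̄_E|_{G_K}` absolutely irreducible + (Im); BCS: (irr_ℚ) + `V = ∅` (+ (sur))).
[cite: BurungaleCastellaSkinner2025, Thm. 1.4.1 and Rem. 1.4.2 (p. 4 of arXiv:2405.00270v2)]
[cite: YanZhu2024MainConjNonCM, Thm. 4.2 (1) with the (Im) clause] -/
theorem conclusion_of_yanZhu_thm42_of_bigIm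
    (h : YanZhu2026.thm42_XOrd₂_isTorsion_charIdeal_le_perrinRiou)
    (ι : integralClosure ℚ ℂ →+* ℂ_[p]) (W : WeierstrassCurve ℚ) [W.IsElliptic] [W.IsGloballyMinimal]
    (κ₁ κ₂ : ZpExtension K p) (γ₁ γ₂ : absoluteGaloisGroup K)
    [Fact (ZpExtension.IsTopGeneratorPair κ₁ κ₂ γ₁ γ₂)] {N : ℕ} [NeZero N]
    (π : ModularParametrizationData W N) (hp : 3 ≤ p) (hord : GoodOrd W p) (hK : IsImaginaryQuadratic K)
    (hsplit : ((Ideal.span {(p : ℤ)}).primesOver (𝓞 K)).ncard = 2) (hHeeg : SatisfiesHeegnerHypothesis N K)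
    (habs : ∀ ρ : ModPGaloisRep K (ZMod p) 2, (W.baseChange K).IsTorsionGaloisRep p ρ →
      FramedRep.IsAbsolutelyIrreducible ρ) (hIm : BigIm W p) :
    ∃ F : CycAntiSeries p, IsHidaRankinLFunction ι W κ₁ κ₂ π.f F ∧ IsCongruenceIntegral π.f F ∧
      Module.IsTorsion (IwasawaAlgebra₂ p) ((W.baseChange K).XOrd₂ p κ₁ κ₂ γ₁ γ₂) ∧
      (IdealLeSpanRat (WeierstrassCurve.XOrd₂.charIdeal (W.baseChange K) p κ₁ κ₂ γ₁ γ₂)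
          (perrinRiouLFunction W π F) ∧
        SpanLeIdealRat (perrinRiouLFunction W π F)
          (WeierstrassCurve.XOrd₂.charIdeal (W.baseChange K) p κ₁ κ₂ γ₁ γ₂)) ∧
      (IdealLeSpan (WeierstrassCurve.XOrd₂.charIdeal (W.baseChange K) p κ₁ κ₂ γ₁ γ₂)
          (perrinRiouLFunction W π F) ∧
        SpanLeIdeal (perrinRiouLFunction W π F)
          (WeierstrassCurve.XOrd₂.charIdeal (W.baseChange K) p κ₁ κ₂ γ₁ γ₂)) := by
  obtain ⟨F, hF, hc, htor, hle, hge⟩ := h ι W K κ₁ κ₂ γ₁ γ₂ π hp hord hK hsplit hHeeg habs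
  exact ⟨F, hF, hc, htor, ⟨hle.rat, (hge hIm).rat⟩, hle, hge hIm⟩

end API

end Literature.NumberTheory.EllipticCurves.BurungaleCastellaSkinner2025

end
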